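/- Copyright: the b2b-balaban cell (near-miss cell 7), T⁴-continuum fan-out, lineage t4-ne7b-p1 (node U5c COUNT
member).  Released under the licence of the surrounding project. -/
import Summits.QuantumFields.BalabanUV.T4Continuum.Support.HistoryBankingShrunkLedger
import Summits.QuantumFields.BalabanUV.T4Continuum.Support.HistoryBankingVolumePlug

/-!
# M5-2d (A3d), file 3 — THE SHRUNK LEDGER IN THE END's VARIABLES AND THE M5-2c PLUG AT WEIGHT `cvol` (owner module of
row NE7b, lineage `t4-ne7b-p1` gen 50; re-open object (α), ruling R-OWNER-49-2 (3) «G-M5-2 … repair = (α)-M5-2d»;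
PRE-POSITIONING ONLY)

Summits-side support leaf of the T⁴-continuum cell (rung (B)+1 on a FINITE torus only; NOT infinite volume, NOT the
mass gap, NOT the Clay statement; NOT a proof of the spine estimate NE7b — the cell's OWN estimate, NOT PRINTED, NOT
PROVED).  [folklore] by-name composition: the sibling `HistoryBankingShrunkLedger.shrunk_volume_le_lifeCost` (M5-2d file
2) through M5-2a's shape-blindness lemmas (`HistoryBankingFlatWitness.{dictWT_shape_comp, lifeCost_shape_comp}`) and
M5-2c's plug calculus (`HistoryBankingVolumePlug.{blin_toPGen_eq_birthWT_genT, birthWT_smul,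
pshapeTH_mul_exp_le_shapeTH_of_weighted}`); nothing printed is asserted, no cite-tagged hypothesis, no `def`, zero `sorry`.

WHAT.  The three theorems of `HistoryBankingFlatWitness` §2 ∕ `HistoryBankingVolumePlug` §3 with M5-1b's volume
hypotheses (`hLu0 hLu hsmall huΦ`) REPLACED by M5-2d's (`hΓ0`, the cumulative growth `hΓ : u_n ≤ Γ·u_t` (`t ≤ n`),
`hsmall : 1122^d·16·21^d·Γ ≤ 2^j∕2`, the LAG-FREE floor display `huS : u_t·(6·1122^d) ≤ floorK C K R t`) and the class
weight `2^{d+3}` REPLACED by `cvol d j Γ`: **`shrunk_volume_le_lifeCost_genT`** (the `genT` headline),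
**`exp_volume_le_genT_shrunk`**, **`credit_mul_volume_le_pshapeTH_costT_shrunk`**, and **`credit_mul_volume_le_shapeTH_shrunk`**
— under `C.a + θᵥ ≤ ½γ₀A₁²` and the volume-slack display **`cvol d j Γ·u_j ≤ θᵥ·p₀(g_j)²`** at the births of `genT c`,
print's credit prefactor times the live volume factor is below `shapeTH Prod.fst C Δ Λ′ R g K 0 (genT c)` — conclusion
VERBATIM `credit_mul_volume_le_shapeTH`'s.  The record twin (the (α) assembly's volume fields at these displays) and the
supplier at print's letter are NOT here (custodian ∕ leaf-06, by INTERFACE REQUEST).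

HONEST: the lineage's own bookkeeping; NE7b NOT proved; spine 0∕9.  HONEST DEPENDENCY (cell): continuum YM on T⁴ ⇐
BetaPertH ∧ nine spine estimates (0∕9 proved); BetaPertH ⇐ (D1) ∧ (D4) ∧ CAP+tail.  This file changes none of it.
-/

open Finset
open Literature.MathematicalPhysics.QuantumFieldTheory.Balaban1983to89
open Literature.MathematicalPhysics.QuantumFieldTheory.Balaban1983to89.B13ScaleTransfer
open Literature.MathematicalPhysics.QuantumFieldTheory.Balaban1983to89.B16SProfile
open T4PersistenceDictionary T4PrintedShapeBanking T4TaggedShapeBanking T4BankedInduction T4BranchingRecordsGas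
open T4PartnerMultiplicity
open Summit.QuantumFields.BalabanUV.T4Continuum.LateMergers
open Summit.QuantumFields.BalabanUV.T4Continuum.HistoryConstants
open Summit.QuantumFields.BalabanUV.T4Continuum.HistoryAdmissible
open Summit.QuantumFields.BalabanUV.T4Continuum.HistoryRealise
open Summit.QuantumFields.BalabanUV.T4Continuum.HistoryRealiseWeak
open Summit.QuantumFields.BalabanUV.T4Continuum.HistoryGen
open Summit.QuantumFields.BalabanUV.T4Continuum.HistoryBankingPedigreeLedger
open Summit.QuantumFields.BalabanUV.T4Continuum.HistoryBankingBirthBookings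
open Summit.QuantumFields.BalabanUV.T4Continuum.HistoryBankingFlatJunction
open Summit.QuantumFields.BalabanUV.T4Continuum.HistoryBankingFlatWitness
open Summit.QuantumFields.BalabanUV.T4Continuum.HistoryBankingVolumePlug
open Summit.QuantumFields.BalabanUV.T4Continuum.HistoryBankingShrunkLedger

namespace Summit.QuantumFields.BalabanUV.T4Continuum.HistoryBankingShrunkWitness

noncomputable section

variable {d : ℕ} {L : ℕ} {s R : ℕ → ℕ} {C : T4PrintedShapeBanking.Consts} {α π : Type*} [DecidableEq α]
  [DecidableEq π]

/-! ## §1 The headline in the END's variables -/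

/-- **THE SHRUNK LEDGER FOR A LIVE COMPONENT OF A TERM's PEDIGREE** (M5-2d; the `genT` form of
`shrunk_volume_le_lifeCost`, hypotheses as `flat_volume_le_lifeCost_genT`'s with the volume displays replaced):
`Σ_{m≤K} u_m·compSum id (Pd.toPGen cell c) m ≤ lifeCost (dictWT Prod.fst R C.n₁) (costT Prod.fst C K R) (Pd.genT c)
+ cvol d j Γ·blin u (Pd.toPGen cell c)`. [folklore] -/
theorem shrunk_volume_le_lifeCost_genT (hL : 4 ≤ L) (hdrop : ∀ m, DropCtl s m) (hR : ∀ t, 1 ≤ R t)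
    (hn₁ : 13 ≤ C.n₁) (hE₂ : 0 ≤ C.E₂) (hE₃ : 0 ≤ C.E₃) (Pd : Pedigree α π)
    (cell : π → Pt d × Finset (Pt d)) (hS : ∀ c c', Part.old c' true ∈ Pd.parts c → Pd.step c' + 1 = Pd.step c)
    (c : α) {Z : Finset (Pt d)} (hP : RealisesW L s R (Pd.toPGen cell c) Z)
    (hW : (Pd.genT c).WF (dictWT Prod.fst R C.n₁)) {K : ℕ} (hPK : (Pd.toPGen cell c).lastStep ≤ K)
    (hK : K < (Pd.genT c).reach (dictWT Prod.fst R C.n₁)) {u : ℕ → ℝ} (hu : ∀ n, 0 ≤ u n) {Γ : ℝ}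
    (hΓ0 : 0 ≤ Γ) (hΓ : ∀ t n, t ≤ n → u n ≤ Γ * u t) {j : ℕ} (hj1 : 1 ≤ j)
    (hsmall : (1122 : ℝ) ^ d * 16 * 21 ^ d * Γ ≤ 2 ^ j / 2)
    (huS : ∀ t, t ≤ K → u t * (6 * 1122 ^ d) ≤ floorK C K R t)
    (huE₂ : ∀ n, n ≤ K → u n * (15 * 126 ^ d) ≤ C.E₂ * (R n : ℝ) ^ C.q')
    (huE₃ : ∀ n, n ≤ K → u n * (24 * 126 ^ d) ≤ C.E₃ * (R n : ℝ) ^ C.q') :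
    ∑ m ∈ Finset.range (K + 1), u m * compSum L s (fun v => (v : ℝ)) (Pd.toPGen cell c) m ≤
      lifeCost (dictWT Prod.fst R C.n₁) (costT Prod.fst C K R) (Pd.genT c) + cvol d j Γ * blin u (Pd.toPGen cell c) := by
  classical
  have hsh : relabel (shape ∘ Prod.fst) (Pd.genT c) = (Pd.toPGen cell c).toGen := Pd.shape_genT_eq_toGen cell hS c
  have hW' : (Pd.genT c).WF (dictWT (shape ∘ Prod.fst) R C.n₁) := by rw [dictWT_shape_comp]; exact hW
  have hK' : K < (Pd.genT c).reach (dictWT (shape ∘ Prod.fst) R C.n₁) := by rw [dictWT_shape_comp]; exact hK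
  have h := shrunk_volume_le_lifeCost (sh := shape ∘ Prod.fst) hL hdrop hR hn₁ hE₂ hE₃ hP hsh hW' hPK hK' hu hΓ0 hΓ hj1
    hsmall huS huE₂ huE₃
  rwa [lifeCost_shape_comp] at h

/-! ## §2 The plug: the live volume factor in the booked-cost currency, `κ := costT`, weight `cvol` -/

/-- **THE LIVE VOLUME FACTOR IN THE BOOKED-COST CURRENCY** (shrunk ledger): `exp (Σ_{m≤K} u_m·compSum id (toPGen cell
c) m) ≤ exp (lifeCost …) · exp (birthWT Prod.fst (cvol d j Γ·u) (genT c))`. [folklore] -/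
theorem exp_volume_le_genT_shrunk (hL : 4 ≤ L) (hdrop : ∀ m, DropCtl s m) (hR : ∀ t, 1 ≤ R t)
    (hn₁ : 13 ≤ C.n₁) (hE₂ : 0 ≤ C.E₂) (hE₃ : 0 ≤ C.E₃) (Pd : Pedigree α π)
    (cell : π → Pt d × Finset (Pt d)) (hS : ∀ c c', Part.old c' true ∈ Pd.parts c → Pd.step c' + 1 = Pd.step c)
    (c : α) {Z : Finset (Pt d)} (hP : RealisesW L s R (Pd.toPGen cell c) Z)
    (hW : (Pd.genT c).WF (dictWT Prod.fst R C.n₁)) {K : ℕ} (hPK : (Pd.toPGen cell c).lastStep ≤ K)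
    (hK : K < (Pd.genT c).reach (dictWT Prod.fst R C.n₁)) {u : ℕ → ℝ} (hu : ∀ n, 0 ≤ u n) {Γ : ℝ}
    (hΓ0 : 0 ≤ Γ) (hΓ : ∀ t n, t ≤ n → u n ≤ Γ * u t) {j : ℕ} (hj1 : 1 ≤ j)
    (hsmall : (1122 : ℝ) ^ d * 16 * 21 ^ d * Γ ≤ 2 ^ j / 2)
    (huS : ∀ t, t ≤ K → u t * (6 * 1122 ^ d) ≤ floorK C K R t)
    (huE₂ : ∀ n, n ≤ K → u n * (15 * 126 ^ d) ≤ C.E₂ * (R n : ℝ) ^ C.q')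
    (huE₃ : ∀ n, n ≤ K → u n * (24 * 126 ^ d) ≤ C.E₃ * (R n : ℝ) ^ C.q') :
    Real.exp (∑ m ∈ Finset.range (K + 1), u m * compSum L s (fun v => (v : ℝ)) (Pd.toPGen cell c) m) ≤
      Real.exp (lifeCost (dictWT Prod.fst R C.n₁) (costT Prod.fst C K R) (Pd.genT c)) *
        Real.exp (birthWT Prod.fst (fun n => cvol d j Γ * u n) (Pd.genT c)) := by
  rw [← Real.exp_add, Real.exp_le_exp, birthWT_smul, ← blin_toPGen_eq_birthWT_genT Pd cell hS c hW u]
  exact shrunk_volume_le_lifeCost_genT hL hdrop hR hn₁ hE₂ hE₃ Pd cell hS c hP hW hPK hK hu hΓ0 hΓ hj1 hsmall huS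
    huE₂ huE₃

/-- **THE `priceM` SHAPE WITH `κ := costT`** (shrunk ledger): print's credit prefactor of the live member, times its volume
factor, times the compensating factor `e^{−birthWT Prod.fst (cvol·u) (genT c)}`, is below
`pshapeTH Prod.fst O C Δ Λ′ R g 0 (costT Prod.fst C K R) (genT c)`. [folklore] -/
theorem credit_mul_volume_le_pshapeTH_costT_shrunk (O : PrintedO1s) (Δ Λ' : ℝ) (g : ℕ → ℝ) (hL : 4 ≤ L)
    (hdrop : ∀ m, DropCtl s m) (hR : ∀ t, 1 ≤ R t) (hn₁ : 13 ≤ C.n₁) (hE₂ : 0 ≤ C.E₂) (hE₃ : 0 ≤ C.E₃)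
    (Pd : Pedigree α π) (cell : π → Pt d × Finset (Pt d))
    (hS : ∀ c c', Part.old c' true ∈ Pd.parts c → Pd.step c' + 1 = Pd.step c) (c : α) {Z : Finset (Pt d)}
    (hP : RealisesW L s R (Pd.toPGen cell c) Z) (hW : (Pd.genT c).WF (dictWT Prod.fst R C.n₁)) {K : ℕ}
    (hPK : (Pd.toPGen cell c).lastStep ≤ K) (hK : K < (Pd.genT c).reach (dictWT Prod.fst R C.n₁)) {u : ℕ → ℝ}
    (hu : ∀ n, 0 ≤ u n) {Γ : ℝ} (hΓ0 : 0 ≤ Γ) (hΓ : ∀ t n, t ≤ n → u n ≤ Γ * u t) {j : ℕ} (hj1 : 1 ≤ j)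
    (hsmall : (1122 : ℝ) ^ d * 16 * 21 ^ d * Γ ≤ 2 ^ j / 2)
    (huS : ∀ t, t ≤ K → u t * (6 * 1122 ^ d) ≤ floorK C K R t)
    (huE₂ : ∀ n, n ≤ K → u n * (15 * 126 ^ d) ≤ C.E₂ * (R n : ℝ) ^ C.q')
    (huE₃ : ∀ n, n ≤ K → u n * (24 * 126 ^ d) ≤ C.E₃ * (R n : ℝ) ^ C.q') :
    0 ≤ Δ → 0 ≤ Λ' →
      Δ * (Λ' ^ partnerAges (PEv.step ∘ Prod.fst) (Pd.genT c) *
          Real.exp (-credits (pcredit O C g ∘ Prod.fst) (Pd.genT c))) *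
        Real.exp (∑ m ∈ Finset.range (K + 1), u m * compSum L s (fun v => (v : ℝ)) (Pd.toPGen cell c) m) *
        Real.exp (-birthWT Prod.fst (fun n => cvol d j Γ * u n) (Pd.genT c)) ≤
      pshapeTH Prod.fst O C Δ Λ' R g 0 (costT Prod.fst C K R) (Pd.genT c) := by
  intro hΔ hΛ
  have h := exp_volume_le_genT_shrunk hL hdrop hR hn₁ hE₂ hE₃ Pd cell hS c hP hW hPK hK hu hΓ0 hΓ hj1 hsmall huS huE₂
    huE₃
  unfold pshapeTH
  rw [padW_zero]
  have hvol : Real.exp (∑ m ∈ Finset.range (K + 1), u m * compSum L s (fun v => (v : ℝ)) (Pd.toPGen cell c) m) *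
      Real.exp (-birthWT Prod.fst (fun n => cvol d j Γ * u n) (Pd.genT c)) ≤
        Real.exp (lifeCost (dictWT Prod.fst R C.n₁) (costT Prod.fst C K R) (Pd.genT c)) := by
    have hB := Real.exp_pos (-birthWT Prod.fst (fun n => cvol d j Γ * u n) (Pd.genT c))
    calc _ ≤ Real.exp (lifeCost (dictWT Prod.fst R C.n₁) (costT Prod.fst C K R) (Pd.genT c)) *
          Real.exp (birthWT Prod.fst (fun n => cvol d j Γ * u n) (Pd.genT c)) *
          Real.exp (-birthWT Prod.fst (fun n => cvol d j Γ * u n) (Pd.genT c)) :=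
        mul_le_mul_of_nonneg_right h hB.le
      _ = _ := by rw [mul_assoc, ← Real.exp_add, add_neg_cancel, Real.exp_zero, mul_one]
  have hpre : 0 ≤ Δ * (Λ' ^ partnerAges (PEv.step ∘ Prod.fst) (Pd.genT c) *
      Real.exp (-credits (pcredit O C g ∘ Prod.fst) (Pd.genT c))) :=
    mul_nonneg hΔ (mul_nonneg (pow_nonneg hΛ _) (Real.exp_pos _).le)
  calc _ = Δ * (Λ' ^ partnerAges (PEv.step ∘ Prod.fst) (Pd.genT c) *
        Real.exp (-credits (pcredit O C g ∘ Prod.fst) (Pd.genT c))) *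
        (Real.exp (∑ m ∈ Finset.range (K + 1), u m * compSum L s (fun v => (v : ℝ)) (Pd.toPGen cell c) m) *
          Real.exp (-birthWT Prod.fst (fun n => cvol d j Γ * u n) (Pd.genT c))) := by ring
    _ ≤ Δ * (Λ' ^ partnerAges (PEv.step ∘ Prod.fst) (Pd.genT c) *
        Real.exp (-credits (pcredit O C g ∘ Prod.fst) (Pd.genT c))) *
        Real.exp (lifeCost (dictWT Prod.fst R C.n₁) (costT Prod.fst C K R) (Pd.genT c)) :=
      mul_le_mul_of_nonneg_left hvol hpre
    _ = _ := by ring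

/-- **… AND, UNDER THE VOLUME SLACK AT WEIGHT `cvol`, BELOW THE TH EXIT'S SHAPE WITHOUT THE COMPENSATING FACTOR**: with
`C.a + θᵥ ≤ ½γ₀A₁²` and the display `cvol d j Γ·u_j ≤ θᵥ·p₀(g_j)²` at the births of `genT c`, print's credit prefactor
times the live volume factor is below `shapeTH Prod.fst C Δ Λ′ R g K 0 (genT c)` — conclusion VERBATIM
`HistoryBankingVolumePlug.credit_mul_volume_le_shapeTH`'s. [folklore] -/
theorem credit_mul_volume_le_shapeTH_shrunk {O : PrintedO1s} {θv : ℝ} (hslack : C.a + θv ≤ O.γ₀ * O.A₁ ^ 2 / 2)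
    {Δ Λ' : ℝ} (hΔ : 0 ≤ Δ) (hΛ : 0 ≤ Λ') (g : ℕ → ℝ) (hL : 4 ≤ L) (hdrop : ∀ m, DropCtl s m)
    (hR : ∀ t, 1 ≤ R t) (hn₁ : 13 ≤ C.n₁) (hE₂ : 0 ≤ C.E₂) (hE₃ : 0 ≤ C.E₃) (Pd : Pedigree α π)
    (cell : π → Pt d × Finset (Pt d)) (hS : ∀ c c', Part.old c' true ∈ Pd.parts c → Pd.step c' + 1 = Pd.step c)
    (c : α) {Z : Finset (Pt d)} (hP : RealisesW L s R (Pd.toPGen cell c) Z)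
    (hW : (Pd.genT c).WF (dictWT Prod.fst R C.n₁)) {K : ℕ} (hPK : (Pd.toPGen cell c).lastStep ≤ K)
    (hK : K < (Pd.genT c).reach (dictWT Prod.fst R C.n₁)) {u : ℕ → ℝ} (hu : ∀ n, 0 ≤ u n) {Γ : ℝ}
    (hΓ0 : 0 ≤ Γ) (hΓ : ∀ t n, t ≤ n → u n ≤ Γ * u t) {j : ℕ} (hj1 : 1 ≤ j)
    (hsmall : (1122 : ℝ) ^ d * 16 * 21 ^ d * Γ ≤ 2 ^ j / 2)
    (huS : ∀ t, t ≤ K → u t * (6 * 1122 ^ d) ≤ floorK C K R t)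
    (huE₂ : ∀ n, n ≤ K → u n * (15 * 126 ^ d) ≤ C.E₂ * (R n : ℝ) ^ C.q')
    (huE₃ : ∀ n, n ≤ K → u n * (24 * 126 ^ d) ≤ C.E₃ * (R n : ℝ) ^ C.q')
    (huθ : ∀ e ∈ (Pd.genT c).events, (Prod.fst e).kind = 0 →
      cvol d j Γ * u (Prod.fst e).step ≤ θv * p0Profile C.A₀ C.p₀ (g (Prod.fst e).step) ^ 2) :
    Δ * (Λ' ^ partnerAges (PEv.step ∘ Prod.fst) (Pd.genT c) *
          Real.exp (-credits (pcredit O C g ∘ Prod.fst) (Pd.genT c))) *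
        Real.exp (∑ m ∈ Finset.range (K + 1), u m * compSum L s (fun v => (v : ℝ)) (Pd.toPGen cell c) m) ≤
      shapeTH Prod.fst C Δ Λ' R g K 0 (Pd.genT c) := by
  have h1 := credit_mul_volume_le_pshapeTH_costT_shrunk O Δ Λ' g hL hdrop hR hn₁ hE₂ hE₃ Pd cell hS c hP hW hPK hK hu
    hΓ0 hΓ hj1 hsmall huS huE₂ huE₃ hΔ hΛ
  have h2 := pshapeTH_mul_exp_le_shapeTH_of_weighted (Prod.fst : Lab α π → PEv) hslack hΔ hΛ R g K 0
    (κ := costT Prod.fst C K R) (G := Pd.genT c) (u := fun n => cvol d j Γ * u n) huθ (fun _ _ => le_rfl)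
  have hB := Real.exp_pos (birthWT Prod.fst (fun n => cvol d j Γ * u n) (Pd.genT c))
  have h3 := mul_le_mul_of_nonneg_right h1 hB.le
  rw [mul_assoc _ (Real.exp (-birthWT Prod.fst (fun n => cvol d j Γ * u n) (Pd.genT c))), ← Real.exp_add,
    neg_add_cancel, Real.exp_zero, mul_one] at h3
  exact h3.trans h2

end

end Summit.QuantumFields.BalabanUV.T4Continuum.HistoryBankingShrunkWitness
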